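import Summits.ABC.IUTFork.Thm311LogKummer
import Literature.IUT.HodgeTheaters.Conventions
import HarnessLib

/-!
# [IUTchIII] Theorem 3.11 in the author's terms, D: (iii) Θ×μ_LGP-Link Compatibility, and Theorem 3.11 assembled

Record-only file (D-0012) of the abc-iut cell (seat abc-iut-c312-1); TAKES NO SIDE. Sequel to
`Thm311Sig` (A), `Thm311Multirad` (B), `Thm311LogKummer` (C). This file types [IUTchIII] Theorem 3.11
(iii) (kurims pp. 156–159): "The various Kummer isomorphisms of (ii) satisfy compatibility properties with
the various horizontal arrows — i.e., Θ×μ_LGP-links — of the LGP-Gaussian log-theta-lattice under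
consideration as follows: (a) … Relative to this Kummer isomorphism, the full poly-isomorphism of
`F⊢×μ`-prime-strips `F⊢×μ_△(^{n,∘}D⊢_△) ⥲ F⊢×μ_△(^{n+1,∘}D⊢_△)` is compatible with the full poly-isomorphism of
`F⊢×μ`-prime-strips `^{n,m}F⊢×μ_△ ⥲ ^{n+1,m}F⊢×μ_△` induced [cf. Theorem 1.5, (ii)] by the horizontal arrows …
(b) … the full poly-isomorphism … `F⊢×μ_env(^{n,∘}D_>) ⥲ F⊢×μ_env(^{n+1,∘}D_>)` is compatible with the full
poly-isomorphism … `^{n,m}F⊢×μ_△ ⥲ ^{n+1,m}F⊢×μ_△` … (c) … (d) … in the sense that these constructions are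
stabilized/equivariant/functorial with respect to arbitrary automomorphisms of the domain and codomain of
these horizontal arrows of the LGP-Gaussian log-theta-lattice."

## The poly-isomorphism calculus ([IUTchI] §0, p. 33, read on the page)

"we define a poly-morphism `A → B` to be a collection of morphisms `A → B` …; if all of the morphisms in
the collection are isomorphisms, then we shall refer to the poly-morphism as a poly-isomorphism … We
define the full poly-isomorphism `A ⥲ B` to be the poly-morphism given by the collection of all
isomorphisms `A ⥲ B`. The composite of a poly-morphism `{f_i : A → B}_{i ∈ I}` with a poly-morphism
`{g_j : B → C}_{j ∈ J}` is defined to be the poly-morphism given by the set [i.e., where "multiplicities"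
are ignored] `{g_j ∘ f_i : A → C}_{(i,j) ∈ I×J}`." — the tree's `Literature.IUT.HodgeTheaters.PolyIso`
(`Set (X ≅ Y)`, `.full`, `.comp`; landed by abc-iut-L5-t1, [IUTchI] §0) is USED, not re-declared. READINGS
fixed here (the text does not define them): a square of poly-isomorphisms "is compatible" / commutes `:=` the two composite
poly-morphisms COINCIDE AS SETS (`SqCommutes`); a poly-isomorphism is "stabilized … with respect to
arbitrary automorphisms of the domain and codomain" `:=` pre- and post-composition with the induced
automorphisms maps it into itself (`Stabilized`); a single isomorphism is "equivariant" `:=` it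
intertwines the induced automorphisms (`Equivariant`).

## What the kernel then sees (bookkeeping, neutral)

`PolyIsoCalc.sqCommutes_full`: a square whose horizontal sides are FULL poly-isomorphisms commutes, relative to
ANY vertical isomorphisms, in ANY category; `PolyIsoCalc.stabilized_full`: a full poly-isomorphism is
stabilized by ALL automorphisms. Hence (iii) (a) and (iii) (b) AS TYPED (`PartIIIa`, `PartIIIb`) are
THEOREMS of the signature (`partIIIa_holds`, `partIIIb_holds`): they hold in every instantiation and
constrain nothing. Both printed positions say as much in prose — the author: these assertions "follow
immediately from the definitions" (Proof of Thm. 3.11, p. 159) and the gluing by a full poly-isomorphism is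
deliberate (Rmk. 3.11.1 (ii); (IPL) Rmk. 3.11.1 (iii)); LANA Rem. 8.2.1 (p. 42): "the assertion that
two BPSs are "linked," in the sense that there exists an isomorphism between them, is a vacuous assertion
since the category of BPSs is a connected groupoid"; Scholze–Stix §2.2. What is NOT a tautology
at this level: the stabilization of the NON-full poly-isomorphisms of (c), (d) (`permR`, `permM` — "the
poly-isomorphism `^{n,∘}R ⥲ ^{n+1,∘}R` induced by any permutation symmetry of the étale-picture") and the
equivariance of the single Kummer isomorphisms; these stay HYPOTHESES (`PartIIIc`, `PartIIId`). The
"up to (Ind1), (Ind2), (Ind3)" clauses of (c), (d) are typed against `Thm311Multirad`/`Thm311LogKummer` as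
`EvalCompatUpToInd` and PROVED from (i) (`evalCompatUpToInd_of_multiradialCompat`).

Sources read on the page: [IUTchIII] pp. 48–50 (Thm. 1.5), 58–61 (Prop. 2.1), 72–75 (Cor. 2.3),
156–159 (Thm. 3.11 (iii), Proof), 159–160 (Rmk. 3.11.1 (i)(ii)); [IUTchI] p. 33 (§0); LANA report p. 42.
[claim: Mochizuki2012, status: disputed] [cite: LANA2026Report, Rem. 8.2.1 p. 42]
Deliberately NOT here: mono-theta environments, the `F^{⋊±}_l`-symmetry, evaluation maps as maps
(campaign M: abc-iut-L6-t1/t2/t3, abc-iut-L2-t2/t4); any judgement.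
-/

noncomputable section

namespace Summit.ABC

namespace IUTFork

namespace Thm311

open CategoryTheory

/-! ## 1. Poly-isomorphism calculus over `Literature.IUT.HodgeTheaters.PolyIso` ([IUTchI] §0) -/

open Literature.IUT.HodgeTheaters (PolyIso)

namespace PolyIsoCalc

universe v u

variable {C : Type u} [Category.{v} C]

/-- The poly-isomorphism consisting of one isomorphism. [folklore] -/
def single {X Y : C} (f : X ≅ Y) : PolyIso X Y := {f}

/-- READING of "the poly-isomorphism `B ⥲ B'` is compatible, relative to the isomorphisms `A ⥲ B`,
`A' ⥲ B'`, with the poly-isomorphism `A ⥲ A'`": the square of poly-morphisms commutes AS SETS,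
`(A ⥲ A') ≫ (A' ⥲ B') = (A ⥲ B) ≫ (B ⥲ B')` ([IUTchI] §0 composite of poly-morphisms). [folklore] -/
def SqCommutes {A A' B B' : C} (top : PolyIso A A') (bot : PolyIso B B') (left : A ≅ B)
    (right : A' ≅ B') : Prop :=
  PolyIso.comp top (single right) = PolyIso.comp (single left) bot

/-- READING of "stabilized … with respect to arbitrary automorphisms of the domain and codomain": the
given automorphisms map the poly-isomorphism into itself by pre- and post-composition. [folklore] -/
def Stabilized {X Y : C} (P : PolyIso X Y) (GX : Set (X ≅ X)) (GY : Set (Y ≅ Y)) : Prop :=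
  ∀ a ∈ GX, ∀ b ∈ GY, ∀ f ∈ P, a ≪≫ f ≪≫ b ∈ P

/-- READING of "equivariant" for a single isomorphism `κ : X ⥲ Y` with respect to given pairs of
automorphisms of `X` and `Y`: `κ` intertwines them. [folklore] -/
def Equivariant {X Y : C} (κ : X ≅ Y) (pairs : Set ((X ≅ X) × (Y ≅ Y))) : Prop :=
  ∀ p ∈ pairs, p.1 ≪≫ κ = κ ≪≫ p.2

/-- Full, then a single isomorphism, is full. [folklore] -/
theorem comp_full_single {A A' B' : C} (right : A' ≅ B') :
    PolyIso.comp (PolyIso.full A A') (single right) = PolyIso.full A B' := by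
  ext h
  refine ⟨fun _ => Set.mem_univ _, fun _ => ?_⟩
  exact Set.mem_image2.2 ⟨h ≪≫ right.symm, Set.mem_univ _, right, rfl,
    by rw [Iso.trans_assoc, Iso.symm_self_id, Iso.trans_refl]⟩

/-- A single isomorphism, then full, is full. [folklore] -/
theorem comp_single_full {A B B' : C} (left : A ≅ B) :
    PolyIso.comp (single left) (PolyIso.full B B') = PolyIso.full A B' := by
  ext h
  refine ⟨fun _ => Set.mem_univ _, fun _ => ?_⟩
  exact Set.mem_image2.2 ⟨left, rfl, left.symm ≪≫ h, Set.mem_univ _,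
    by rw [← Iso.trans_assoc, Iso.self_symm_id, Iso.refl_trans]⟩

/-- A square whose horizontal sides are FULL poly-isomorphisms commutes relative to ANY vertical
isomorphisms — in any category, for any objects. [folklore] -/
theorem sqCommutes_full {A A' B B' : C} (left : A ≅ B) (right : A' ≅ B') :
    SqCommutes (PolyIso.full A A') (PolyIso.full B B') left right := by
  unfold SqCommutes; rw [comp_full_single, comp_single_full]

/-- A FULL poly-isomorphism is stabilized by all automorphisms of its domain and codomain. [folklore] -/
theorem stabilized_full {X Y : C} (GX : Set (X ≅ X)) (GY : Set (Y ≅ Y)) :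
    Stabilized (PolyIso.full X Y) GX GY :=
  fun _ _ _ _ _ _ => Set.mem_univ _

end PolyIsoCalc

/-! ## 2. The objects of (iii) (signature) -/

/-- SIGNATURE for the objects [IUTchIII] Thm. 3.11 (iii) quotes: the category of `F⊢×μ`-prime-strips
([IUTchII] Def. 4.9 (vii)) with the Frobenius-like `^{n,m}F⊢×μ_△` ([IUTchII] Cor. 4.10 (i); Thm. 1.5 (ii))
and the vertically coric `F⊢×μ_△(^{n,∘}D⊢_△)` (Thm. 1.5 (iii)), the Kummer isomorphism of (iii) (a) "induced —
by applying the `F^{⋊±}_l`-symmetry … — [cf. Theorem 1.5, (iii)]", the strips `^{n,m}F⊢×μ_env`,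
`F⊢×μ_env(^{n,∘}D_>)` with the "natural isomorphisms" of Prop. 2.1 (vi) ((iii) (b)); a category of radial
data with `^{n,∘}R` (Cor. 2.3 (ii)) and "the poly-isomorphism `^{n,∘}R ⥲ ^{n+1,∘}R` induced by any permutation
symmetry of the étale-picture" ((iii) (c)); a category for the data
`[{π_1^{κ-sol}(^{n,∘}D^⊛) ↷ M^⊛_{∞κ}(^{n,∘}D^⊚)}_j → M_{∞κv}(^{n,∘}D_{v_j}) ⊆ M_{∞κ×v}(^{n,∘}D_{v_j})]_{v ∈ V}` of
[IUTchII] Cor. 4.7 (iii) with its permutation-symmetry poly-isomorphism ((iii) (d)); and the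
automorphisms of the domain `^{n,m}HT` and codomain `^{n+1,m}HT` of the horizontal arrow, with the
automorphisms they induce, by functoriality, on these objects. TODO-merge: abc-iut-L6-t2 ([IUTchII]
Def. 4.9, Cor. 4.7, 4.10), abc-iut-L6-t3 ([IUTchIII] Thm. 1.5, Prop. 2.1, Cor. 2.3), abc-iut-L5-t4
([IUTchI] Def. 6.13, automorphisms of Hodge theaters). [claim: Mochizuki2012, status: disputed] -/
structure LinkData where
  /-- objects of the category of `F⊢×μ`-prime-strips -/
  Strip : Type
  [catStrip : Category.{0} Strip]
  /-- `^{n,m}F⊢×μ_△` -/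
  Fdelta : ℤ → ℤ → Strip
  /-- `F⊢×μ_△(^{n,∘}D⊢_△)` (vertically coric) -/
  FdeltaD : ℤ → Strip
  /-- the Kummer isomorphism `^{n,m}F⊢×μ_△ ⥲ F⊢×μ_△(^{n,∘}D⊢_△)` of (iii) (a) -/
  kumDelta : ∀ n m : ℤ, Fdelta n m ≅ FdeltaD n
  /-- `F⊢×μ_env(^{n,∘}D_>)` (Prop. 2.1 (ii)) -/
  FenvD : ℤ → Strip
  /-- the natural isomorphism `F⊢×μ_△(^{n,∘}D⊢_△) ⥲ F⊢×μ_env(^{n,∘}D_>)` (Prop. 2.1 (vi)) -/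
  natEnvD : ∀ n : ℤ, FdeltaD n ≅ FenvD n
  /-- objects of the category of radial data (Cor. 2.3) -/
  Rad : Type
  [catRad : Category.{0} Rad]
  /-- `^{n,∘}R` -/
  R : ℤ → Rad
  /-- the poly-isomorphism `^{n,∘}R ⥲ ^{n+1,∘}R` induced by a permutation symmetry of the étale-picture -/
  permR : ∀ n : ℤ, PolyIso (R n) (R (n + 1))
  /-- objects of the category of the `κ`-sol/`∞κ` data of [IUTchII] Cor. 4.7 (iii) -/
  Kap : Type
  [catKap : Category.{0} Kap]
  /-- that data at the vertical line `n` -/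
  Mk : ℤ → Kap
  /-- its permutation-symmetry poly-isomorphism `n → n+1` -/
  permM : ∀ n : ℤ, PolyIso (Mk n) (Mk (n + 1))
  /-- automorphisms of the Hodge theater `^{n,m}HT^{Θ±ell NF}` -/
  AutHT : ℤ → ℤ → Type
  /-- induced automorphism of `^{n,m}F⊢×μ_△` -/
  onDelta : ∀ n m : ℤ, AutHT n m → (Fdelta n m ≅ Fdelta n m)
  /-- induced automorphism of `F⊢×μ_△(^{n,∘}D⊢_△)` (through the associated `D`-theater) -/
  onDeltaD : ∀ n m : ℤ, AutHT n m → (FdeltaD n ≅ FdeltaD n)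
  /-- induced automorphism of `^{n,∘}R` -/
  onR : ∀ n m : ℤ, AutHT n m → (R n ≅ R n)
  /-- induced automorphism of the `κ`-sol/`∞κ` data -/
  onM : ∀ n m : ℤ, AutHT n m → (Mk n ≅ Mk n)

namespace LinkData

/-- The category of `F⊢×μ`-prime-strips (signature field). [folklore] -/
instance (K : LinkData) : Category K.Strip := K.catStrip

/-- The category of radial data (signature field). [folklore] -/
instance (K : LinkData) : Category K.Rad := K.catRad

/-- The category of `κ`-sol/`∞κ` data (signature field). [folklore] -/
instance (K : LinkData) : Category K.Kap := K.catKap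

variable (K : LinkData)

/-- "the full poly-isomorphism of `F⊢×μ`-prime-strips `^{n,m}F⊢×μ_△ ⥲ ^{n+1,m}F⊢×μ_△` induced [cf. Theorem 1.5,
(ii)] by the horizontal arrows of the LGP-Gaussian log-theta-lattice". [claim: Mochizuki2012, status: disputed] -/
def horizontal (n m : ℤ) : PolyIso (K.Fdelta n m) (K.Fdelta (n + 1) m) := PolyIso.full _ _

/-! ## 3. Theorem 3.11 (iii), one declaration per sub-item -/

/-- **(iii) (a)** (p. 156–157): "The first Kummer isomorphism of the first display of (ii) induces … a
Kummer isomorphism `^{n,m}F⊢×μ_△ ⥲ F⊢×μ_△(^{n,∘}D⊢_△)` [cf. Theorem 1.5, (iii)]. Relative to this Kummer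
isomorphism, the full poly-isomorphism of `F⊢×μ`-prime-strips `F⊢×μ_△(^{n,∘}D⊢_△) ⥲ F⊢×μ_△(^{n+1,∘}D⊢_△)` is
compatible with the full poly-isomorphism of `F⊢×μ`-prime-strips `^{n,m}F⊢×μ_△ ⥲ ^{n+1,m}F⊢×μ_△` induced [cf.
Theorem 1.5, (ii)] by the horizontal arrows of the LGP-Gaussian log-theta-lattice under consideration
[cf. Theorem 1.5, (iii)]." Typed: the square (horizontal full poly-isomorphisms, vertical Kummer
isomorphisms) commutes as poly-morphisms. [claim: Mochizuki2012, status: disputed] -/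
@[claim "Mochizuki2012" "disputed"] def PartIIIa : Prop :=
  ∀ n m : ℤ, PolyIsoCalc.SqCommutes (K.horizontal n m) (PolyIso.full (K.FdeltaD n) (K.FdeltaD (n + 1)))
    (K.kumDelta n m) (K.kumDelta (n + 1) m)

/-- **(iii) (b)** (p. 157): "… natural isomorphisms of associated `F⊢×μ`-prime-strips `^{n,m}F⊢×μ_△ ⥲
^{n,m}F⊢×μ_env`, `F⊢×μ_△(^{n,∘}D⊢_△) ⥲ F⊢×μ_env(^{n,∘}D_>)` [cf. Proposition 2.1, (vi)]. Relative to these natural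
isomorphisms and to the Kummer isomorphism discussed in (a) above, the full poly-isomorphism of
`F⊢×μ`-prime-strips `F⊢×μ_env(^{n,∘}D_>) ⥲ F⊢×μ_env(^{n+1,∘}D_>)` is compatible with the full poly-isomorphism
of `F⊢×μ`-prime-strips `^{n,m}F⊢×μ_△ ⥲ ^{n+1,m}F⊢×μ_△` induced … by the horizontal arrows … [cf. Corollary 2.3,
(iii)]." Typed: the square with verticals Kummer-then-natural commutes as poly-morphisms.
[claim: Mochizuki2012, status: disputed] -/
@[claim "Mochizuki2012" "disputed"] def PartIIIb : Prop :=
  ∀ n m : ℤ, PolyIsoCalc.SqCommutes (K.horizontal n m) (PolyIso.full (K.FenvD n) (K.FenvD (n + 1)))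
    (K.kumDelta n m ≪≫ K.natEnvD n) (K.kumDelta (n + 1) m ≪≫ K.natEnvD (n + 1))

/-- **(iii) (c)**, structural part (p. 157–158): "The algorithmic construction of these Kummer
isomorphisms and poly-isomorphisms of projective systems of mono-theta environments, as well as of the
poly-isomorphism `^{n,∘}R ⥲ ^{n+1,∘}R` induced by any permutation symmetry of the étale-picture …
`^{n,∘}HT^{D-Θ±ell NF} ⥲ ^{n+1,∘}HT^{D-Θ±ell NF}` is compatible with the horizontal arrows …, e.g., with the full
poly-isomorphism of `F⊢×μ`-prime-strips `^{n,m}F⊢×μ_△ ⥲ ^{n+1,m}F⊢×μ_△` …, in the sense that these constructions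
are stabilized/equivariant/functorial with respect to arbitrary automomorphisms of the domain and
codomain of these horizontal arrows". Typed: the Kummer isomorphism of (a) is equivariant for the
automorphisms induced by `Aut(^{n,m}HT)`, and `^{n,∘}R ⥲ ^{n+1,∘}R` is stabilized by those induced by
`Aut(^{n,m}HT)` and `Aut(^{n+1,m}HT)`. HYPOTHESIS. [claim: Mochizuki2012, status: disputed] -/
@[claim "Mochizuki2012" "disputed"] def PartIIIc : Prop :=
  ∀ n m : ℤ,
    PolyIsoCalc.Equivariant (K.kumDelta n m) {p | ∃ a : K.AutHT n m, p = (K.onDelta n m a, K.onDeltaD n m a)} ∧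
    PolyIsoCalc.Stabilized (K.permR n) {f | ∃ a : K.AutHT n m, f = K.onR n m a}
      {g | ∃ b : K.AutHT (n + 1) m, g = K.onR (n + 1) m b}

/-- **(iii) (d)**, structural part (p. 158): "The algorithmic construction of the Kummer isomorphisms of
the first display of (ii) …, as well as of the poly-isomorphisms between the data
`[{π_1^{κ-sol}(^{n,∘}D^⊛) ↷ M^⊛_{∞κ}(^{n,∘}D^⊚)}_j → M_{∞κv}(^{n,∘}D_{v_j}) ⊆ M_{∞κ×v}(^{n,∘}D_{v_j})]_{v ∈ V} ⥲ [… n+1 …]_{v ∈ V}`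
[i.e., of the second line of the first display of [IUTchII], Corollary 4.7, (iii)] induced by any
permutation symmetry of the étale-picture … are compatible [cf. the discussion of Remark 2.3.2] with the
full poly-isomorphism of `F⊢×μ`-prime-strips `^{n,m}F⊢×μ_△ ⥲ ^{n+1,m}F⊢×μ_△` …, in the sense that these
constructions are stabilized/equivariant/functorial with respect to arbitrary automomorphisms of the
domain and codomain of these horizontal arrows". Typed: that poly-isomorphism is stabilized by the induced
automorphisms. HYPOTHESIS. [claim: Mochizuki2012, status: disputed] -/
@[claim "Mochizuki2012" "disputed"] def PartIIId : Prop :=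
  ∀ n m : ℤ, PolyIsoCalc.Stabilized (K.permM n) {f | ∃ a : K.AutHT n m, f = K.onM n m a}
    {g | ∃ b : K.AutHT (n + 1) m, g = K.onM (n + 1) m b}

/-- **(iii) (a) holds in every instantiation** — bookkeeping: squares of FULL poly-isomorphisms commute
relative to any vertical isomorphisms (`PolyIsoCalc.sqCommutes_full`). [folklore] -/
theorem partIIIa_holds : K.PartIIIa := fun n m => PolyIsoCalc.sqCommutes_full (K.kumDelta n m) (K.kumDelta (n + 1) m)

/-- **(iii) (b) holds in every instantiation** (same reason). [folklore] -/
theorem partIIIb_holds : K.PartIIIb := fun n m =>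
  PolyIsoCalc.sqCommutes_full (K.kumDelta n m ≪≫ K.natEnvD n) (K.kumDelta (n + 1) m ≪≫ K.natEnvD (n + 1))

/-- The horizontal arrow itself is stabilized by arbitrary automorphisms of domain and codomain — the
sense in which a FULL poly-isomorphism is "compatible" with everything (cf. LANA Rem. 8.2.1: ""linked," in
the sense that there exists an isomorphism between them, is a vacuous assertion since the category of BPSs
is a connected groupoid"). [cite: LANA2026Report, Rem. 8.2.1 p. 42] -/
theorem horizontal_stabilized (n m : ℤ) (GX : Set (K.Fdelta n m ≅ K.Fdelta n m))
    (GY : Set (K.Fdelta (n + 1) m ≅ K.Fdelta (n + 1) m)) : PolyIsoCalc.Stabilized (K.horizontal n m) GX GY :=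
  PolyIsoCalc.stabilized_full GX GY

/-- IF an instantiation makes the permutation-symmetry poly-isomorphisms `^{n,∘}R ⥲ ^{n+1,∘}R` full and the
Kummer isomorphisms equivariant, (iii) (c) holds (the stabilization part is then free). [folklore] -/
theorem partIIIc_of_full (hR : ∀ n, K.permR n = PolyIso.full _ _)
    (hκ : ∀ n m, PolyIsoCalc.Equivariant (K.kumDelta n m)
      {p | ∃ a : K.AutHT n m, p = (K.onDelta n m a, K.onDeltaD n m a)}) : K.PartIIIc :=
  fun n m => ⟨hκ n m, by rw [hR n]; exact PolyIsoCalc.stabilized_full _ _⟩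

end LinkData

/-! ## 4. Theorem 3.11 assembled -/

/-- **"The situation of Theorem 3.11"** in full: index data, coric log-shells, the data (a)(b)(c) of every
vertical line (`Situation`), the Frobenius-like columns seen through the Kummer isomorphisms
(`LatticeSituation`), and the objects of (iii) (`LinkData`). This is the referent of Cor. 3.12's "Suppose
that we are in the situation of Theorem 3.11". [claim: Mochizuki2012, status: disputed] -/
structure FullSituation (T : ThetaIndex) extends LatticeSituation T where
  /-- the objects of (iii) -/
  link : LinkData

namespace FullSituation

variable {T : ThetaIndex} (S : FullSituation T)

/-- **(iii) (c)/(d), final clauses** (p. 158): "the algorithmic construction of …, the various related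
Kummer isomorphisms, and the various evaluation maps implicit in the portion of the log-Kummer
correspondence discussed in (ii), (b) [resp. (ii), (c)], are compatible with the horizontal arrows of the
LGP-Gaussian log-theta-lattice under consideration, i.e., up to the indeterminacies (Ind1), (Ind2), (Ind3)
described in (i), (ii) [cf. also the discussion of Remark 3.11.4 below]". READING at this level: what the
evaluation maps produce at the line `n+1` (the splitting monoids and number fields, transported by Kummer)
lies among the possible images `^{n,∘}R^{LGP}` of the line-`n` data. [claim: Mochizuki2012, status: disputed] -/
@[claim "Mochizuki2012" "disputed"] def EvalCompatUpToInd : Prop := ∀ n : ℤ, S.D (n + 1) ∈ S.RLGP n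

/-- BOOKKEEPING: the final clauses of (iii) (c)/(d), as read here, follow from (i)'s multiradial
compatibility. [folklore] -/
theorem evalCompatUpToInd_of_multiradialCompat (h : S.MultiradialCompat) : S.EvalCompatUpToInd :=
  fun n => S.mem_RLGP_of_multiradialCompat h n (n + 1)

/-- **Theorem 3.11 (iii)** of the situation. [claim: Mochizuki2012, status: disputed] -/
@[claim "Mochizuki2012" "disputed"] def PartIII : Prop :=
  S.link.PartIIIa ∧ S.link.PartIIIb ∧ S.link.PartIIIc ∧ S.link.PartIIId ∧ S.EvalCompatUpToInd

/-- **[IUTchIII] Theorem 3.11 (Multiradial Algorithms via LGP-Monoids/Frobenioids)**, (i) ∧ (ii) ∧ (iii),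
as one `Prop` over the full situation (`FullSituation.Statement`). HYPOTHESIS — the disputed theorem as the author states it, typed
over named signatures; never asserted here. [claim: Mochizuki2012, status: disputed] -/
@[claim "Mochizuki2012" "disputed"] def Statement : Prop := S.PartI ∧ S.toLatticeSituation.PartII ∧ S.PartIII

/-- What Theorem 3.11 amounts to at this level of typing: (i) ∧ [(ii)(a)(b)(c) ∧ (Ind3) for every column] ∧
[(iii)(c)(d) structural parts] — (iii)(a), (iii)(b) are automatic, and the remaining clauses follow from
these (`Column.partII_iff`, `evalCompatUpToInd_of_multiradialCompat`). [folklore] -/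
theorem statement_iff : S.Statement ↔
    S.PartI ∧ (∀ n, (S.col n).KummerA (S.D n) ∧ (S.col n).KummerB (S.D n) ∧ (S.col n).KummerC (S.D n) ∧
      (S.col n).Ind3 (S.D n)) ∧ S.link.PartIIIc ∧ S.link.PartIIId := by
  constructor
  · rintro ⟨h1, h2, -, -, hc, hd, -⟩
    exact ⟨h1, fun n => ((S.col n).partII_iff (S.D n)).1 (h2 n), hc, hd⟩
  · rintro ⟨h1, h2, hc, hd⟩
    refine ⟨h1, fun n => ((S.col n).partII_iff (S.D n)).2 (h2 n), S.link.partIIIa_holds,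
      S.link.partIIIb_holds, hc, hd, S.evalCompatUpToInd_of_multiradialCompat h1.2.2⟩

end FullSituation

end Thm311

end IUTFork

end Summit.ABC

end
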